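import Literature.Probability.RandomPlanarGeometry.SLEDrivingCoupling
import Literature.Probability.Process.BrownianPair
import Literature.Probability.Process.ItoCalculus
import HarnessLib

/-!
# Identification of SLE_κ by Lévy's characterisation of the driving process

Topic `Literature/Probability/RandomPlanarGeometry` (trunk `Stoch`). This file assembles, once
for all lattice models, the *last* step of every proof of convergence of an interface to chordal
SLE_κ by the martingale-observable method (Lawler–Schramm–Werner 2004, §3; Chelkak–Duminil-Copin–
Hongler–Kemppainen–Smirnov 2014, §3; Duminil-Copin–Smirnov 2012, Prop. 6.7):

> "we … conclude that both coefficients `W_t` and `W_t² - 3t` are martingales. As `W_t` is almost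
> surely continuous, Lévy's theorem implies that `W_t = √3 B_t`, where `B_t` is a standard
> Brownian motion, for any subsequential limit of the curves `γ^δ`." (CDHKS 2014, end of §3.)

That is: once a random curve (a probability measure `ν` on `CurveClass ℂ`, typically a
subsequential limit of interface laws) is known to be a.s. described by a Loewner chain with a
continuous driving process `W` (Kemppainen–Smirnov), and `W/√κ` is a continuous local martingale
with quadratic variation `t`, then `ν` *is* the chordal SLE_κ law of `Literature.Probability.RandomPlanarGeometry.IsSLELaw`. The three
ingredients:

* **Lévy's characterisation** — the tree's named fact `Literature.Probability.Process.levy_characterisation`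
  (`Process/ItoCalculus.lean`): `W/√κ` is a Brownian motion (`ProbabilityTheory.IsBrownianReal`).
* **Equality of path-space laws** — the tree's `IsPreBrownianReal.map_path_eq`
  (`Process/BrownianPair.lean`: two pre-Brownian motions with measurable marginals have the same
  law on `ℝ≥0 → ℝ`, by uniqueness of projective limits), specialised here to the canonical
  Brownian motion: the law of `W/√κ` under `ν` is the law of the canonical Brownian path
  `brownianPath` (`map_paths_eq_map_brownianPath`), and the law of `√κ X` that of `sleDriving κ`
  (`map_eq_map_sleDriving_of_isPreBrownianReal`).
* **Transfer** — PROVED in the tree, `SLEDrivingCoupling.lean` (`isSLEDrivingCoupling_of_drivingLaw`: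
  a driving functional with the Brownian path law and a.s. driving the curve yields a Brownian
  coupling; `isSLELaw_of_isSLEDrivingCoupling`: a coupling identifies the SLE_κ law, given the
  SLE_κ trace theorems).

and the assembled criterion `isSLELaw_of_isLocalMartingale_driving` (PROVED; its only named-fact
inputs are `levy_characterisation`, `HasSLETrace κ` and `tendsto_norm_sleTrace_atTop`). Also the
spelling `Loewner.IsDrivenBy Φ b W c` (DEFINITION: the curve class `c` is the compactified
`Φ`-image of the curve generating the Loewner chain of `W` — the almost-sure clause of
`IsSLEDrivingCoupling` and of `IsSLECurve` with the driving function as a parameter, used by the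
lattice-model facts to state "the limit is described by the Loewner evolution with driving process
`W`"), with the unfolding lemmas `isSLEDrivingCoupling_iff_ae_isDrivenBy`,
`isSLEDrivingCoupling_of_drivingLaw_of_isDrivenBy`, `IsSLECurve.exists_ae_isDrivenBy`, and the
canonical-space non-vacuity `ae_exists_isDrivenBy_sleDriving` (a.e. Brownian path drives a curve
class through any prescribed uniformizing map; from the trace theorems and Carathéodory).

First consumer: `LatticeModels/InterfaceSLEIdentification.lean` (critical spin-Ising interfaces,
CDHKS Thm. 1: the identification fact for the leftmost interface reduced to facts about its
driving process).

## Design choices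

* The probability space of the limit is `(CurveClass ℂ, ν)` itself and the driving process is a
  function `W : CurveClass ℂ → (ℝ≥0 → ℝ)` with measurable marginals (so that `W` is measurable for
  the product σ-algebra, `measurable_pi_lambda`); the filtration is a parameter (any filtration
  for which the martingale properties hold; CDHKS use the one generated by `W`).
* Local martingales and `HasQuadraticVariation` (the hypothesis format of `levy_characterisation`)
  rather than the true martingales of the sources: weaker hypotheses, same conclusion.
* Continuity of `W` is an explicit almost-sure hypothesis (`Loewner.IsGeneratedByCurve` carries
  no continuity of the driving function; uniqueness of the generating curve needs it).

## Mathlib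

USED: `ProbabilityTheory.IsPreBrownianReal`/`IsBrownianReal`, `Measure.map_map`,
`measurable_pi_lambda`, `Filtration`. From the tree: `IsPreBrownianReal.map_path_eq`
(`Process/BrownianPair.lean`), `isPreBrownianReal_brownian`, `preWienerMeasure`, `brownian`,
`brownianPath`, `sleDriving`, `sleTrace`, `IsSLECurve`/`IsSLELaw`, `IsSLEDrivingCoupling`,
`Loewner.IsGeneratedByCurve`, `IsCompactifiedImage`, `nodeValue`/`continuous_nodeValue`,
`IsLocalMartingale`, `HasQuadraticVariation`, `levy_characterisation`. Mathlib has no SLE and no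
Lévy characterisation.

## References

* D. Chelkak, H. Duminil-Copin, C. Hongler, A. Kemppainen, S. Smirnov, *Convergence of Ising
  interfaces to Schramm's SLE curves*, C. R. Math. Acad. Sci. Paris 352 (2014) 157–161, §1
  ("Chordal Loewner evolution") and §3 (last paragraph).
* G. F. Lawler, O. Schramm, W. Werner, *Conformal invariance of planar loop-erased random walks
  and uniform spanning trees*, Ann. Probab. 32 (2004), §3.
* H. Duminil-Copin, S. Smirnov, *Conformal invariance of lattice models*, Clay Math. Proc. 15
  (2012), Prop. 6.7.
* G. F. Lawler, *Conformally Invariant Processes in the Plane*, AMS (2005), Def. 6.1, §6.3.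
* S. Rohde, O. Schramm, *Basic properties of SLE*, Ann. of Math. 161 (2005), Thm. 5.1, Thm. 7.1.
* P. Lévy, *Processus stochastiques et mouvement brownien* (1948); D. Revuz, M. Yor, *Continuous
  Martingales and Brownian Motion* (1999), Ch. IV, Thm. (3.6).
* O. Kallenberg, *Foundations of Modern Probability*, 2nd ed. (2002), Thm. 6.16, Thm. 13.5.
-/

noncomputable section

open MeasureTheory ProbabilityTheory Filter Topology Set
open UpperHalfPlane (upperHalfPlaneSet)
open scoped NNReal ENNReal

namespace Literature.Probability.RandomPlanarGeometry

/-! ### Curves driven by a driving function, in a Dobrushin domain -/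

/-- `Loewner.IsDrivenBy Φ b W c`: the curve class `c` (a curve modulo reparametrisation in the
plane) is **driven by the function `W : [0, ∞) → ℝ` through `Φ`, ending at `b`**: the chordal Loewner chain
of `W` is generated by a curve `γ` in the closed upper half-plane (`Loewner.IsGeneratedByCurve`,
half-plane capacity parametrisation) and `c` is the class of the time-compactified image of `γ`
under `Φ` ending at `b` (`IsCompactifiedImage`: `s ↦ Φ (γ (s / (1 - s)))`, `1 ↦ b`). With `Φ`
the boundary extension of a chordal uniformizing map `ℍₒ → D` and `b = D.pt 1` this is "the
curve `c` in `(D; a, b)` can be fully described by the Loewner evolution with driving term `W`"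
(CDHKS 2014, §1, "Chordal Loewner evolution"; Kemppainen–Smirnov 2017, §1.2); with `W = √κ B`
it is the almost-sure clause of `IsSLECurve` and of `IsSLEDrivingCoupling`
(`isSLEDrivingCoupling_iff_ae_isDrivenBy`). (Lawler 2005, §6.3; CDHKS 2014, §1.)
[cite: Lawler2005, §6.3] -/
def Loewner.IsDrivenBy (Φ : ℂ → ℂ) (b : ℂ) (W : ℝ≥0 → ℝ) (c : CurveClass ℂ) : Prop :=
  ∃ γ : ℝ≥0 → ℂ, Loewner.IsGeneratedByCurve W γ ∧
    ∃ cc : Curve ℂ, c = CurveClass.mk cc ∧ IsCompactifiedImage Φ γ b cc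

/-- A Brownian coupling of the driving process of `μ` (`IsSLEDrivingCoupling`,
`SLEDrivingCoupling.lean`) is a measure with marginals `μ` and `preWienerMeasure` under which
a.s. the curve is driven by the SLE_κ driving function of the path (unfolding). (Lawler 2005,
§6.3.) [folklore] -/
theorem isSLEDrivingCoupling_iff_ae_isDrivenBy {κ : ℝ≥0} {D : DobrushinDomain}
    {φ : ConformalEquiv upperHalfPlaneSet D.carrier} {μ : Measure (CurveClass ℂ)}
    {ν : Measure (CurveClass ℂ × (ℝ≥0 → ℝ))} :
    IsSLEDrivingCoupling κ D φ μ ν ↔ ν.map Prod.fst = μ ∧ ν.map Prod.snd = Process.preWienerMeasure ∧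
      ∀ᵐ p ∂ν, Loewner.IsDrivenBy φ.boundaryExtension (D.pt 1) (sleDriving κ p.2) p.1 :=
  Iff.rfl

/-- `isSLEDrivingCoupling_of_drivingLaw` (`SLEDrivingCoupling.lean`) with its almost-sure
hypothesis spelled by `Loewner.IsDrivenBy`: a driving functional `Wt` with the law of the canonical
Brownian path, a.s. continuous and such that `√κ · Wt c` drives `c`, yields a Brownian coupling.
(Duminil-Copin–Smirnov 2012, Prop. 6.7.) [folklore] -/
theorem isSLEDrivingCoupling_of_drivingLaw_of_isDrivenBy {κ : ℝ≥0} {D : DobrushinDomain}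
    {φ : ConformalEquiv upperHalfPlaneSet D.carrier} {μ : Measure (CurveClass ℂ)}
    [IsFiniteMeasure μ] (Wt : CurveClass ℂ → ℝ≥0 → ℝ) (hWm : AEMeasurable Wt μ)
    (hlaw : μ.map Wt = Process.preWienerMeasure.map brownianPath)
    (hW : ∀ᵐ c ∂μ, Continuous (Wt c) ∧
      Loewner.IsDrivenBy φ.boundaryExtension (D.pt 1) (fun t ↦ Real.sqrt κ * Wt c t) c) :
    ∃ ν, IsSLEDrivingCoupling κ D φ μ ν :=
  isSLEDrivingCoupling_of_drivingLaw Wt hWm hlaw hW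

/-- An SLE random curve is a.s. driven by the SLE driving function through the boundary extension
of its uniformizing map (unfolding of `IsSLECurve`). (Lawler 2005, §6.3.) [cite: Lawler2005, §6.3] -/
theorem IsSLECurve.exists_ae_isDrivenBy {κ : ℝ≥0} {D : DobrushinDomain}
    {Γ : (ℝ≥0 → ℝ) → CurveClass ℂ} (h : IsSLECurve κ D Γ) :
    ∃ φ : ConformalEquiv upperHalfPlaneSet D.carrier, D.IsChordalUniformizing φ ∧
      ∀ᵐ ω ∂Process.preWienerMeasure,
        Loewner.IsDrivenBy φ.boundaryExtension (D.pt 1) (sleDriving κ ω) (Γ ω) := by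
  obtain ⟨-, φ, hφ, hae⟩ := h
  refine ⟨φ, hφ, ?_⟩
  filter_upwards [hae] with ω hω
  exact ⟨sleTrace κ ω, hω.1, hω.2⟩

/-- **The SLE driving function a.s. drives a curve class through any prescribed chordal
uniformizing map** (non-vacuity of `Loewner.IsDrivenBy` on the canonical space; the deterministic
half of the existence of chordal SLE_κ in `(D; a, b)`, cf. `exists_isSLECurve_through`): for a.e.
Brownian path the chain of `√κ B` is generated by its trace (`HasSLETrace κ`: Rohde–Schramm 2005,
Thm. 5.1, and Lawler–Schramm–Werner 2004 for `κ = 8`), the trace is transient (RS05 Thm. 7.1: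
`htr`), and the boundary extension `Φ` of `φ` is continuous on the closed half-plane
(Carathéodory, proved in the tree: `JordanDomain.continuousOn_boundaryExtension_holds`) with
value `b` at infinity, so that the compactified image `s ↦ Φ(γ(s/(1-s)))`, `1 ↦ b` (`nodeValue`)
is a continuous curve (`continuous_nodeValue`). PROVED. (Lawler 2005, §6.3.)
[cite: RohdeSchramm2005, Thm. 5.1 and Thm. 7.1] -/
theorem ae_exists_isDrivenBy_sleDriving {κ : ℝ≥0} (hκt : HasSLETrace κ)
    (htr : tendsto_norm_sleTrace_atTop) (hκ : 0 < κ) (D : DobrushinDomain)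
    {φ : ConformalEquiv upperHalfPlaneSet D.carrier} (hφ : D.IsChordalUniformizing φ) :
    ∀ᵐ ω ∂Process.preWienerMeasure,
      ∃ c, Loewner.IsDrivenBy φ.boundaryExtension (D.pt 1) (sleDriving κ ω) c := by
  set Φ : ℂ → ℂ := φ.boundaryExtension with hΦdef
  set b : ℂ := D.pt 1 with hbdef
  have hΦcont : ContinuousOn Φ (closure upperHalfPlaneSet) :=
    JordanDomain.continuousOn_boundaryExtension_holds D.toJordanDomain φ
  have hΦinf : Tendsto Φ (cocompact ℂ ⊓ 𝓟 (closure upperHalfPlaneSet)) (𝓝 b) :=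
    φ.tendsto_boundaryExtension_cocompact hΦcont hφ.2
  filter_upwards [ae_isGeneratedByCurve_sleTrace hκt, htr hκ] with ω h1 h2
  have hcont : Continuous (nodeValue Φ b (sleTrace κ ω)) :=
    continuous_nodeValue hΦcont hΦinf h1.continuous (fun t ↦ sleTrace_mem_closure κ ω t)
      (tendsto_cocompact_of_tendsto_norm_atTop h2)
  exact ⟨CurveClass.mk ⟨⟨nodeValue Φ b (sleTrace κ ω), hcont⟩⟩, sleTrace κ ω, h1,
    ⟨⟨nodeValue Φ b (sleTrace κ ω), hcont⟩⟩, rfl, fun s hs ↦ nodeValue_of_lt Φ b _ hs,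
    nodeValue_one Φ b _⟩

/-! ### The path-space law of a Brownian motion -/

/-- **The path law of a pre-Brownian motion with measurable marginals is the law of the
canonical Brownian path** `brownianPath` under the pre-Wiener measure (the tree's
`IsPreBrownianReal.map_path_eq`, uniqueness of projective limits, with the canonical Brownian
motion `brownian`, `isPreBrownianReal_brownian`) — the hypothesis format of
`isSLEDrivingCoupling_of_drivingLaw`. (Kallenberg 2002, Thm. 6.16 and Thm. 13.5.) [folklore] -/
theorem map_paths_eq_map_brownianPath {Ω : Type*} [MeasurableSpace Ω] {P : Measure Ω}
    {X : ℝ≥0 → Ω → ℝ} (hX : IsPreBrownianReal X P) (hXm : ∀ t, Measurable (X t)) :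
    P.map (fun ω t ↦ X t ω) = Process.preWienerMeasure.map brownianPath :=
  hX.map_path_eq isPreBrownianReal_brownian hXm Process.measurable_brownian

/-- **The law of `√κ X`, `X` a pre-Brownian motion with measurable marginals, is the law of the
SLE_κ driving function** `sleDriving κ = √κ B` on the canonical space: push the equality of
path-space laws (`map_paths_eq_map_brownianPath`) forward under the measurable scaling
`w ↦ √κ w`. (Rohde–Schramm 2005, §2; Lawler 2005, Def. 6.1.) [folklore] -/
theorem map_eq_map_sleDriving_of_isPreBrownianReal {Ω : Type*} [MeasurableSpace Ω]
    {P : Measure Ω} {X : ℝ≥0 → Ω → ℝ} (hX : IsPreBrownianReal X P) (hXm : ∀ t, Measurable (X t))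
    (κ : ℝ≥0) :
    P.map (fun ω t ↦ Real.sqrt κ * X t ω) = Process.preWienerMeasure.map (sleDriving κ) := by
  have hsc : Measurable fun (w : ℝ≥0 → ℝ) (t : ℝ≥0) ↦ Real.sqrt κ * w t :=
    measurable_pi_lambda _ fun t ↦ (measurable_pi_apply t).const_mul _
  have e1 : (fun ω t ↦ Real.sqrt κ * X t ω) = (fun w t ↦ Real.sqrt κ * w t) ∘ fun ω t ↦ X t ω :=
    rfl
  have e2 : sleDriving κ = (fun w t ↦ Real.sqrt κ * w t) ∘ brownianPath := rfl
  rw [e1, e2, ← Measure.map_map hsc (measurable_pi_lambda _ hXm),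
    ← Measure.map_map hsc measurable_brownianPath, map_paths_eq_map_brownianPath hX hXm]

/-! ### Identification of SLE_κ by Lévy's characterisation -/

/-- **Martingale identification of chordal SLE_κ** (the last step of the proofs of convergence to
SLE by the martingale-observable method: Lawler–Schramm–Werner 2004, §3; CDHKS 2014, §3, "both
coefficients `W_t` and `W_t² - 3t` are martingales. As `W_t` is almost surely continuous, Lévy's
theorem implies that `W_t = √3 B_t`"; Duminil-Copin–Smirnov 2012, Prop. 6.7). Let `κ > 0` be
such that SLE_κ is generated by a transient curve (`HasSLETrace κ`, `tendsto_norm_sleTrace_atTop`: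
Rohde–Schramm), `ν` a probability measure on `CurveClass ℂ`, `φ` a chordal uniformizing map of
`(D; a, b)` and `W : CurveClass ℂ → ([0, ∞) → ℝ)` a process on `(CurveClass ℂ, ν)` with
measurable marginals, a.s. continuous paths and `W 0 = 0` a.s., such that `ν`-a.e. `c` is driven
by `W c` through `φ` (`Loewner.IsDrivenBy`) and `X = (√κ)⁻¹ W` is a continuous local martingale with
quadratic variation `⟨X⟩ₜ = t` for some filtration (`IsLocalMartingale`,
`HasQuadraticVariation`). Then `ν` is the chordal SLE_κ law in `(D; a, b)`. PROVED: Lévy's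
characterisation (the named fact `levy_characterisation`, `Process/ItoCalculus.lean`) makes `X` a
Brownian motion, whose path law is that of the canonical Brownian path
(`map_paths_eq_map_brownianPath`); the tree's `isSLEDrivingCoupling_of_drivingLaw` turns
`(X, Loewner.IsDrivenBy)` into a Brownian coupling of the driving process, and
`isSLELaw_of_isSLEDrivingCoupling` identifies the law (`SLEDrivingCoupling.lean`).
[cite: CDHKSCRAS2014, §3] [cite: Levy1948] -/
theorem isSLELaw_of_isLocalMartingale_driving {κ : ℝ≥0} (hκt : HasSLETrace κ) (hκ : 0 < κ)
    (htr : tendsto_norm_sleTrace_atTop)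
    (hLevy : Process.levy_characterisation (Ω := CurveClass ℂ) (m := inferInstance))
    {D : DobrushinDomain} {φ : ConformalEquiv upperHalfPlaneSet D.carrier}
    (hφ : D.IsChordalUniformizing φ) {ν : Measure (CurveClass ℂ)} [IsProbabilityMeasure ν]
    {W : CurveClass ℂ → ℝ≥0 → ℝ} (hWm : ∀ t, Measurable fun c ↦ W c t)
    (h0 : ∀ᵐ c ∂ν, W c 0 = 0) (hc : ∀ᵐ c ∂ν, Continuous (W c))
    {𝓕 : Filtration ℝ≥0 (inferInstance : MeasurableSpace (CurveClass ℂ))}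
    (hM : IsLocalMartingale (fun t c ↦ (Real.sqrt κ)⁻¹ * W c t) 𝓕 ν)
    (hQ : Process.HasQuadraticVariation (fun t c ↦ (Real.sqrt κ)⁻¹ * W c t) (fun t _ ↦ (t : ℝ)) 𝓕 ν)
    (hreg : ∀ᵐ c ∂ν, Loewner.IsDrivenBy φ.boundaryExtension (D.pt 1) (W c) c) :
    IsSLELaw κ D ν := by
  set X : ℝ≥0 → CurveClass ℂ → ℝ := fun t c ↦ (Real.sqrt κ)⁻¹ * W c t with hX
  have hXm : ∀ t, Measurable (X t) := fun t ↦ (hWm t).const_mul _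
  have h0' : ∀ᵐ c ∂ν, X 0 c = 0 := by
    filter_upwards [h0] with c hc0
    simp [hX, hc0]
  have hc' : ∀ᵐ c ∂ν, Continuous (X · c) := by
    filter_upwards [hc] with c hcc
    exact continuous_const.mul hcc
  have hBM : IsBrownianReal X ν := hLevy hM h0' hc' hQ
  have hlaw : ν.map (fun c t ↦ X t c) = Process.preWienerMeasure.map brownianPath :=
    map_paths_eq_map_brownianPath hBM.toIsPreBrownianReal hXm
  have hsqrt : Real.sqrt κ ≠ 0 := (Real.sqrt_pos.2 (by exact_mod_cast hκ)).ne'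
  have hWX : ∀ c, (fun t ↦ Real.sqrt κ * X t c) = W c := by
    intro c
    funext t
    simp only [hX]
    rw [← mul_assoc, mul_inv_cancel₀ hsqrt, one_mul]
  obtain ⟨νc, hνc⟩ := isSLEDrivingCoupling_of_drivingLaw_of_isDrivenBy (κ := κ) (φ := φ)
    (fun c t ↦ X t c) (measurable_pi_lambda _ hXm).aemeasurable hlaw (by
      filter_upwards [hc', hreg] with c hcc hr
      exact ⟨hcc, by rw [hWX c]; exact hr⟩)
  exact isSLELaw_of_isSLEDrivingCoupling hκt hκ htr hφ hνc

end Literature.Probability.RandomPlanarGeometry
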